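import Mathlib
import Summits.QuantumFields.BalabanUV.Beta.UnitLatticeResolventWalk

/-!
# `Summit.QuantumFields.BalabanUV.Beta.UnitLatticeProjectionWalk` — rider (ρ1) of route A.3′: the Q̃-PROJECTION
# inverse `(Q̃G₃(x)Q̃*)⁻¹` of B9 (3.186) AT x has an x-UNIFORM walk inversion — (a) walk inversion of ANY `Re`-coercive
# decaying unit-lattice kernel `S` (`K′ := c⁻¹S − 1`), (b) the LOWER coercivity of a sandwich of an inverse from a
# RECONSTRUCTION `R` (`QR = 1`) with bounded energy (completion of squares `w^*A⁻¹w ≥ 2Re r^*w − r^*Ar`), (c) END for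
# `S(x) = sandwich (A + xP) q`, uniformly on `x ∈ [0, X]`

HONEST FRAMING (page 1 of everything in this cell).  Discharging `FlowStep.BetaPertH` would make
Bałaban's ultraviolet stability UNCONDITIONAL — a constructive-QFT result; it is NOT the continuum
limit and NOT the Clay problem.  This module discharges nothing of `BetaPertH`; [folklore] linear algebra,
kernel-checked (unit `b2b-balaban-beta-d4-p3`, road P3 «reduction road», gen 3; rider (ρ1) of the row-D4 owner's
`OUTLINE-D4-NODE-A.md` v1.2.1 §3b: «the Q̃-PROJECTION inverse of (3.186) AT x, (Q̃G₃(x)Q̃*)⁻¹, needs the same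
x-uniform sandwich∕inversion treatment (A.4.5 at x)»).
HONEST DEPENDENCY: continuum YM on T⁴ ⇐ BetaPertH ∧ nine spine estimates (0/9 proved); BetaPertH ⇐
(D1) ∧ (D4) ∧ CAP+tail; G-an2-4 gates asym, D1 and NE2/3/4.

CONTENTS (0 sorry).
* §1 `walkInversion_of_coercive` — `S` with `Re z^*Sz ≥ c‖z‖²`, `c > 0`, `‖S(i,j)‖ ≤ θ_S e^{−κ₀D(i,j)}` ⟹ `S` invertible,
  `S⁻¹ = c⁻¹(1 + K′)⁻¹` with `K′ = c⁻¹S − 1` (decaying with `θ = c⁻¹θ_S + 1`, `1 + K′` `Re`-coercive with `1`) and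
  `WRS κ D S⁻¹ ≤ c⁻¹·N·C_L·(1 − ρ)⁻¹` — `UnitLatticeWalkInversionDecay.walkInversion_of_decay` BY NAME;
* §2 `re_form_inv_ge` — for Hermitian `A` with `Re g^*Ag ≥ 0` and `A` invertible: `2Re(r^*w) − Re(r^*Ar) ≤ Re(w^*A⁻¹w)`
  (expand `(A⁻¹w − r)^*A(A⁻¹w − r) ≥ 0`); `sandwich_coercive_of_reconstruction` — test vectors `q`, reconstruction
  `r` with `Qm r · (Qm q)ᴴ = 1` (i.e. `Σ_x conj(r_y(x)) q_{y′}(x) = δ_{yy′}`: `QR = 1`) and energy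
  `Re (Rᴴ B)^*A(Rᴴ B) ≤ a‖B‖²`, `a > 0` ⟹ `a⁻¹‖B‖² ≤ Re B^*(sandwich A q)B` — the (1.44)-type ∕
  `B9SectEKernel.form_le_of_right_inverse` mechanism over ℂ, in the form that is x-UNIFORM for `A + xP`;
* §3 END `projectionWalkInversion` — `A` Hermitian with `Re ≥ 0`, `P` Hermitian with `Re ≥ 0`, reconstruction energies
  `a_A`, `a_P`; conjugated coercivity `m` of `A + xP` along block weights (A1's budget, instance-side) for the decay;
  then for every `x ∈ [0, X]` the unit-lattice kernel `S(x) = sandwich (A + xP) q` is invertible with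
  `WRS κ D S(x)⁻¹ ≤ (a_A + X a_P)·N·C_L·(1 − ρ)⁻¹`, `C_L`, `ρ` independent of `x`.
NOT HERE: the Woodbury∕(3.186) algebra itself (`B9SectECov`), the U-localisation bookkeeping (A3-loc ∕ (ρ3)), any
instance (which `A`, `P`, `q`, `r`).  NOT summit progress.
-/

open scoped BigOperators Matrix ComplexConjugate
open Finset Matrix

namespace Summit.QuantumFields.BalabanUV.Beta.UnitLatticeProjectionWalk

open Summit.QuantumFields.BalabanUV.Beta.AccretiveCombesThomas
open Summit.QuantumFields.BalabanUV.Beta.AccretiveCombesThomasSandwich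
open Summit.QuantumFields.BalabanUV.Beta.UnitLatticeWalkInversion
open Summit.QuantumFields.BalabanUV.Beta.UnitLatticeWalkInversionDecay
open Summit.QuantumFields.BalabanUV.Beta.UnitLatticeResolventWalk
open Literature.MathematicalPhysics.QuantumFieldTheory.Balaban1983to89.B5Prop11Lower (nsq nsq_nonneg
  star_dotProduct_self)
open Literature.MathematicalPhysics.QuantumFieldTheory.Balaban1983to89.B13PerturbativeStep (wrs WRS WeightHyp)

noncomputable section

variable {X Y : Type*} [Fintype X] [DecidableEq X] [Fintype Y] [DecidableEq Y]

/-! ## §1 Walk inversion of a `Re`-coercive decaying unit-lattice kernel -/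

omit [Fintype Y] in
/-- Decay of `K′ = c⁻¹S − 1`: `‖K′(i,j)‖ ≤ (c⁻¹θ_S + 1)e^{−κ₀D(i,j)}` (the diagonal sits at `D(i,i) = 0`). [folklore] -/
theorem norm_rescale_sub_one_le (S : Matrix Y Y ℂ) {D : Y → Y → ℝ} (hD0 : ∀ i, D i i = 0) {c θS κ₀ : ℝ}
    (hc : 0 < c) (hS : ∀ i j, ‖S i j‖ ≤ θS * Real.exp (-(κ₀ * D i j))) (i j : Y) :
    ‖(((c⁻¹ : ℝ) : ℂ) • S - 1) i j‖ ≤ (c⁻¹ * θS + 1) * Real.exp (-(κ₀ * D i j)) := by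
  rw [Matrix.sub_apply, Matrix.smul_apply, smul_eq_mul]
  have hcS : ‖((c⁻¹ : ℝ) : ℂ) * S i j‖ ≤ c⁻¹ * θS * Real.exp (-(κ₀ * D i j)) := by
    rw [norm_mul, Complex.norm_real, Real.norm_of_nonneg (inv_nonneg.2 hc.le), mul_assoc]
    exact mul_le_mul_of_nonneg_left (hS i j) (inv_nonneg.2 hc.le)
  by_cases hij : i = j
  · subst hij
    rw [Matrix.one_apply_eq, hD0, mul_zero, neg_zero, Real.exp_zero, mul_one]
    rw [hD0, mul_zero, neg_zero, Real.exp_zero, mul_one] at hcS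
    calc ‖((c⁻¹ : ℝ) : ℂ) * S i i - 1‖ ≤ ‖((c⁻¹ : ℝ) : ℂ) * S i i‖ + ‖(1 : ℂ)‖ := norm_sub_le _ _
      _ ≤ c⁻¹ * θS + 1 := by rw [norm_one]; exact add_le_add hcS le_rfl
  · rw [Matrix.one_apply_ne hij, sub_zero]
    calc ‖((c⁻¹ : ℝ) : ℂ) * S i j‖ ≤ c⁻¹ * θS * Real.exp (-(κ₀ * D i j)) := hcS
      _ ≤ (c⁻¹ * θS + 1) * Real.exp (-(κ₀ * D i j)) :=
          mul_le_mul_of_nonneg_right (by linarith) (Real.exp_pos _).le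

/-- `1 + (c⁻¹S − 1)` is `Re`-coercive with constant `1` when `S` is with `c`. [folklore] -/
theorem reCoercive_rescale (S : Matrix Y Y ℂ) {c : ℝ} (hc : 0 < c)
    (hS : ∀ z : Y → ℂ, c * nsq z ≤ (star z ⬝ᵥ (S *ᵥ z)).re) (z : Y → ℂ) :
    1 * nsq z ≤ (star z ⬝ᵥ ((1 + ((((c⁻¹ : ℝ) : ℂ) • S - 1))) *ᵥ z)).re := by
  rw [add_sub_cancel, Matrix.smul_mulVec, dotProduct_smul, smul_eq_mul, Complex.re_ofReal_mul]
  have h := hS z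
  have hc' : c⁻¹ * (c * nsq z) ≤ c⁻¹ * (star z ⬝ᵥ (S *ᵥ z)).re := mul_le_mul_of_nonneg_left h (inv_nonneg.2 hc.le)
  rwa [← mul_assoc, inv_mul_cancel₀ hc.ne', one_mul, ← one_mul (nsq z)] at hc'

/-- **Walk inversion of a `Re`-coercive decaying kernel.**  `S` with `Re z^*Sz ≥ c‖z‖²` (`c > 0`) and
`‖S(i,j)‖ ≤ θ_S e^{−κ₀D(i,j)}`; partition data and profiles as in `walkInversion_of_decay`, with `θ := c⁻¹θ_S + 1`,
`m₀ := 1`.  Then `S` is invertible and `WRS κ D S⁻¹ ≤ c⁻¹·N·C_L·(1 − ρ)⁻¹`. [folklore] -/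
theorem walkInversion_of_coercive {B : Type*} [Fintype B] {D : Y → Y → ℝ} {κ : ℝ} (hw : WeightHyp κ D)
    (hDs : ∀ i j, D i j = D j i) (S : Matrix Y Y ℂ) {c θS κ₀ κ₁ : ℝ} (hc : 0 < c) (hθS : 0 ≤ θS)
    (hcoer : ∀ z : Y → ℂ, c * nsq z ≤ (star z ⬝ᵥ (S *ᵥ z)).re)
    (hS : ∀ i j, ‖S i j‖ ≤ θS * Real.exp (-(κ₀ * D i j)))
    (h : B → Y → ℝ) (E : B → Finset Y) (hsum : ∀ y, ∑ b, h b y ^ 2 = 1) (hsupp : ∀ b y, y ∉ E b → h b y = 0)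
    (habs : ∀ b y, |h b y| ≤ 1) {M N L₁ L : ℝ} (hM : 0 < M) (hLip : ∀ b y y', |h b y - h b y'| ≤ D y y' / M)
    (hN : ∀ y, ((Finset.univ.filter fun b => y ∈ E b).card : ℝ) ≤ N) (hκκ₁ : κ ≤ κ₁)
    (hL₁ : ∀ i, ∑ j, D i j * Real.exp (-((κ₀ - κ₁) * D i j)) ≤ L₁)
    (hL : ∀ i, ∑ j, Real.exp (-((κ₁ - κ) * D i j)) ≤ L) (hL0 : 0 ≤ L)
    (hb1 : κ₁ * (c⁻¹ * θS + 1) * L₁ < 1)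
    (hb2 : 2 * N / M * ((1 - κ₁ * (c⁻¹ * θS + 1) * L₁)⁻¹ * L) * ((c⁻¹ * θS + 1) * L₁) < 1) :
    IsUnit S ∧ WRS κ D S⁻¹ (c⁻¹ * (N * ((1 - κ₁ * (c⁻¹ * θS + 1) * L₁)⁻¹ * L)
      * (1 - 2 * N / M * ((1 - κ₁ * (c⁻¹ * θS + 1) * L₁)⁻¹ * L) * ((c⁻¹ * θS + 1) * L₁))⁻¹)) := by
  set K' : Matrix Y Y ℂ := ((c⁻¹ : ℝ) : ℂ) • S - 1 with hK'
  have hθ : 0 ≤ c⁻¹ * θS + 1 := by positivity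
  have hmain := walkInversion_of_decay hw hDs K' h E hsum hsupp habs hM hLip hN hθ hκκ₁
    (norm_rescale_sub_one_le S hw.zero hc hS) one_pos (reCoercive_rescale S hc hcoer) hL₁ hL hL0 hb1 hb2
  have h1K : 1 + K' = ((c⁻¹ : ℝ) : ℂ) • S := by rw [hK']; abel
  have hcne : ((c⁻¹ : ℝ) : ℂ) ≠ 0 := by exact_mod_cast (inv_ne_zero hc.ne')
  -- S = c • (1 + K′), so S is a unit and S⁻¹ = c⁻¹ • (1 + K′)⁻¹
  have hS_eq : S = ((c : ℝ) : ℂ) • (1 + K') := by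
    rw [h1K, smul_smul]
    have : ((c : ℝ) : ℂ) * ((c⁻¹ : ℝ) : ℂ) = 1 := by exact_mod_cast mul_inv_cancel₀ hc.ne'
    rw [this, one_smul]
  have hU1 : IsUnit (1 + K') := hmain.1
  have hdet1 : IsUnit (1 + K').det := (Matrix.isUnit_iff_isUnit_det _).1 hU1
  have hUS : IsUnit S := by
    rw [hS_eq, Matrix.isUnit_iff_isUnit_det, Matrix.det_smul]
    have hcne' : ((c : ℝ) : ℂ) ≠ 0 := by exact_mod_cast hc.ne'
    exact (IsUnit.pow _ (isUnit_iff_ne_zero.2 hcne')).mul hdet1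
  have hinv : S⁻¹ = ((c⁻¹ : ℝ) : ℂ) • (1 + K')⁻¹ := by
    apply Matrix.inv_eq_right_inv
    rw [hS_eq, Matrix.smul_mul, Matrix.mul_smul, smul_smul, Matrix.mul_nonsing_inv _ hdet1]
    have : ((c : ℝ) : ℂ) * ((c⁻¹ : ℝ) : ℂ) = 1 := by exact_mod_cast mul_inv_cancel₀ hc.ne'
    rw [this, one_smul]
  refine ⟨hUS, ?_⟩
  rw [hinv]
  have hsm := (hmain.2.2).smul (((c⁻¹ : ℝ) : ℂ))
  rwa [Complex.norm_real, Real.norm_of_nonneg (inv_nonneg.2 hc.le)] at hsm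

/-! ## §2 Lower coercivity of a sandwich of an inverse from a reconstruction -/

/-- **Completion of squares**: for Hermitian `A` with `Re g^*Ag ≥ 0` and `A` invertible,
`2Re(r^*w) − Re(r^*Ar) ≤ Re(w^*A⁻¹w)` (expand `(A⁻¹w − r)^*A(A⁻¹w − r) ≥ 0`). [folklore] -/
theorem re_form_inv_ge (A : Matrix X X ℂ) (hH : A.IsHermitian) (hU : IsUnit A)
    (hpsd : ∀ g : X → ℂ, 0 ≤ (star g ⬝ᵥ (A *ᵥ g)).re) (w r : X → ℂ) :
    2 * (star r ⬝ᵥ w).re - (star r ⬝ᵥ (A *ᵥ r)).re ≤ (star w ⬝ᵥ (A⁻¹ *ᵥ w)).re := by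
  have hdet : IsUnit A.det := (Matrix.isUnit_iff_isUnit_det A).1 hU
  have hAinv : A * A⁻¹ = 1 := Matrix.mul_nonsing_inv A hdet
  have hinvA : A⁻¹ * A = 1 := Matrix.nonsing_inv_mul A hdet
  have hHinv : (A⁻¹)ᴴ = A⁻¹ := hH.inv.eq
  set g : X → ℂ := A⁻¹ *ᵥ w - r with hg
  have h0 := hpsd g
  -- expand the form at g
  have hAg : A *ᵥ g = w - A *ᵥ r := by
    rw [hg, Matrix.mulVec_sub, Matrix.mulVec_mulVec, hAinv, Matrix.one_mulVec]
  have hexp : star g ⬝ᵥ (A *ᵥ g)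
      = star w ⬝ᵥ (A⁻¹ *ᵥ w) - star (A⁻¹ *ᵥ w) ⬝ᵥ (A *ᵥ r) - star r ⬝ᵥ w + star r ⬝ᵥ (A *ᵥ r) := by
    rw [hAg, hg, star_sub, sub_dotProduct, dotProduct_sub, dotProduct_sub]
    -- star (A⁻¹ w) ⬝ᵥ w = star w ⬝ᵥ (A⁻¹ w) by Hermitian symmetry of A⁻¹
    have h1 : star (A⁻¹ *ᵥ w) ⬝ᵥ w = star w ⬝ᵥ (A⁻¹ *ᵥ w) := by
      rw [Matrix.star_mulVec, hHinv, ← Matrix.dotProduct_mulVec]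
    rw [h1]; ring
  -- the cross term: star (A⁻¹ w) ⬝ᵥ (A r) = star w ⬝ᵥ r
  have hcross : star (A⁻¹ *ᵥ w) ⬝ᵥ (A *ᵥ r) = star w ⬝ᵥ r := by
    rw [Matrix.star_mulVec, hHinv, ← Matrix.dotProduct_mulVec, Matrix.mulVec_mulVec, hinvA, Matrix.one_mulVec]
  -- star w ⬝ᵥ r = conj (star r ⬝ᵥ w)
  have hconj : star w ⬝ᵥ r = (starRingEnd ℂ) (star r ⬝ᵥ w) := by
    have h := Matrix.star_dotProduct_star r (star w)
    rw [star_star] at h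
    rw [h, Complex.star_def, Complex.conj_conj]
  rw [hexp, hcross, hconj] at h0
  simp only [Complex.sub_re, Complex.add_re, Complex.conj_re] at h0
  linarith

omit [DecidableEq X] in
/-- Biorthogonality in pairing form: `Qm r · (Qm q)ᴴ = 1` gives `(Rᴴ B)^*·(Qᴴ B) = ‖B‖²`. [folklore] -/
theorem star_superpose_dotProduct (q r : Y → X → ℂ) (hbi : Qm r * (Qm q)ᴴ = 1) (B : Y → ℂ) :
    star (superpose r B) ⬝ᵥ superpose q B = ((nsq B : ℝ) : ℂ) := by
  rw [superpose, superpose, Matrix.star_mulVec, Matrix.conjTranspose_conjTranspose, ← Matrix.dotProduct_mulVec,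
    Matrix.mulVec_mulVec, hbi, Matrix.one_mulVec, star_dotProduct_self]

/-- **Lower coercivity of a sandwich of an inverse from a RECONSTRUCTION.**  `A` Hermitian, invertible, `Re g^*Ag ≥ 0`;
test vectors `q` and a reconstruction `r` with `Qm r·(Qm q)ᴴ = 1` (`QR = 1`) whose energy is bounded,
`Re (Rᴴ B)^*A(Rᴴ B) ≤ a‖B‖²`, `a > 0`.  Then `a⁻¹‖B‖² ≤ Re B^*(sandwich A q)B` — completion of squares with
`r ↦ a⁻¹·Rᴴ B`. [folklore] -/
theorem sandwich_coercive_of_reconstruction (A : Matrix X X ℂ) (hH : A.IsHermitian) (hU : IsUnit A)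
    (hpsd : ∀ g : X → ℂ, 0 ≤ (star g ⬝ᵥ (A *ᵥ g)).re) (q r : Y → X → ℂ) (hbi : Qm r * (Qm q)ᴴ = 1) {a : ℝ}
    (ha : 0 < a) (hen : ∀ B : Y → ℂ, (star (superpose r B) ⬝ᵥ (A *ᵥ superpose r B)).re ≤ a * nsq B)
    (B : Y → ℂ) : a⁻¹ * nsq B ≤ (star B ⬝ᵥ (sandwich A q *ᵥ B)).re := by
  rw [form_sandwich_eq]
  set w := superpose q B
  set ρ := superpose r B
  have h := re_form_inv_ge A hH hU hpsd w ((((a⁻¹ : ℝ) : ℂ)) • ρ)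
  -- (λρ)^* w = λ‖B‖², (λρ)^*A(λρ) = λ² ρ^*Aρ
  have h1 : star ((((a⁻¹ : ℝ) : ℂ)) • ρ) ⬝ᵥ w = ((a⁻¹ : ℝ) : ℂ) * ((nsq B : ℝ) : ℂ) := by
    rw [star_smul, smul_dotProduct, star_superpose_dotProduct q r hbi B, smul_eq_mul, Complex.star_def,
      Complex.conj_ofReal]
  have h2 : star ((((a⁻¹ : ℝ) : ℂ)) • ρ) ⬝ᵥ (A *ᵥ ((((a⁻¹ : ℝ) : ℂ)) • ρ))
      = ((a⁻¹ : ℝ) : ℂ) * ((a⁻¹ : ℝ) : ℂ) * (star ρ ⬝ᵥ (A *ᵥ ρ)) := by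
    rw [star_smul, Matrix.mulVec_smul, smul_dotProduct, dotProduct_smul, smul_eq_mul, smul_eq_mul,
      Complex.star_def, Complex.conj_ofReal, mul_assoc]
  rw [h1, h2] at h
  have hre1 : (((a⁻¹ : ℝ) : ℂ) * ((nsq B : ℝ) : ℂ)).re = a⁻¹ * nsq B := by
    rw [← Complex.ofReal_mul, Complex.ofReal_re]
  have hre2 : (((a⁻¹ : ℝ) : ℂ) * ((a⁻¹ : ℝ) : ℂ) * (star ρ ⬝ᵥ (A *ᵥ ρ))).re
      = a⁻¹ * a⁻¹ * (star ρ ⬝ᵥ (A *ᵥ ρ)).re := by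
    rw [← Complex.ofReal_mul, Complex.re_ofReal_mul]
  rw [hre1, hre2] at h
  have hρ := hen B
  have hainv : 0 ≤ a⁻¹ := inv_nonneg.2 ha.le
  have h3 : a⁻¹ * a⁻¹ * (star ρ ⬝ᵥ (A *ᵥ ρ)).re ≤ a⁻¹ * nsq B := by
    calc a⁻¹ * a⁻¹ * (star ρ ⬝ᵥ (A *ᵥ ρ)).re ≤ a⁻¹ * a⁻¹ * (a * nsq B) :=
          mul_le_mul_of_nonneg_left hρ (mul_nonneg hainv hainv)
      _ = a⁻¹ * nsq B := by field_simp
  linarith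

/-! ## §3 END: the projection inverse `(sandwich (A + xP) q)⁻¹`, uniformly on `x ∈ [0, X]` -/

/-- **RIDER (ρ1) IN ABSTRACT KERNEL FORM.**  Fine-lattice `A` Hermitian and `Re`-coercive (`m_A > 0`), `P` Hermitian
with `Re ≥ 0`; conjugation budgets `c_A`, `c_P` of `A`, `P` along the block-constant weights at rate `κ₀`
(`m := m_A − c_A − X·c_P > 0`); test vectors `q` (`‖q_y‖² ≤ N_q`, block-supported) and a reconstruction `r`
(`Qm r·(Qm q)ᴴ = 1`) with energies `a_A > 0`, `a_P ≥ 0`; unit-lattice partition data and profiles as in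
`walkInversion_of_coercive` with `c := (a_A + X·a_P)⁻¹`, `θ_S := N_q/m`.  THEN FOR EVERY `x ∈ [0, X]` the projection
kernel `S(x) = sandwich (A + xP) q` is invertible and `WRS κ D S(x)⁻¹` is bounded by ONE x-free constant. [folklore] -/
theorem projectionWalkInversion {B : Type*} [Fintype B] (A P : Matrix X X ℂ) (hHA : A.IsHermitian)
    (hHP : P.IsHermitian) {mA cA cP X₀ : ℝ} (hmA0 : 0 < mA)
    (hmA : ∀ g : X → ℂ, mA * nsq g ≤ (star g ⬝ᵥ (A *ᵥ g)).re)
    (hP : ∀ g : X → ℂ, 0 ≤ (star g ⬝ᵥ (P *ᵥ g)).re) (blk : X → Y) (D : Y → Y → ℝ) {κ : ℝ} (hw : WeightHyp κ D)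
    (hDs : ∀ i j, D i j = D j i) {κ₀ κ₁ : ℝ} (hκ₀ : 0 ≤ κ₀)
    (hAbud : ∀ y', ∀ z : X → ℂ, (star z ⬝ᵥ (A *ᵥ z)).re - cA * nsq z ≤ (conjForm A κ₀ (fun x => D (blk x) y') z).re)
    (hPbud : ∀ y', ∀ z : X → ℂ, (star z ⬝ᵥ (P *ᵥ z)).re - cP * nsq z ≤ (conjForm P κ₀ (fun x => D (blk x) y') z).re)
    (hcP : 0 ≤ cP) (hX : 0 ≤ X₀) (hm : 0 < mA - cA - X₀ * cP)
    (q r : Y → X → ℂ) (hq : ∀ y x, blk x ≠ y → q y x = 0) {Nq : ℝ} (hNq0 : 0 ≤ Nq)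
    (hNq : ∀ y, nsq (q y) ≤ Nq) (hbi : Qm r * (Qm q)ᴴ = 1) {aA aP : ℝ} (haA : 0 < aA) (haP : 0 ≤ aP)
    (henA : ∀ Bv : Y → ℂ, (star (superpose r Bv) ⬝ᵥ (A *ᵥ superpose r Bv)).re ≤ aA * nsq Bv)
    (henP : ∀ Bv : Y → ℂ, (star (superpose r Bv) ⬝ᵥ (P *ᵥ superpose r Bv)).re ≤ aP * nsq Bv)
    (h : B → Y → ℝ) (E : B → Finset Y) (hsum : ∀ y, ∑ b, h b y ^ 2 = 1) (hsupp : ∀ b y, y ∉ E b → h b y = 0)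
    (habs : ∀ b y, |h b y| ≤ 1) {M N L₁ L : ℝ} (hM : 0 < M) (hLip : ∀ b y y', |h b y - h b y'| ≤ D y y' / M)
    (hN : ∀ y, ((Finset.univ.filter fun b => y ∈ E b).card : ℝ) ≤ N) (hκκ₁ : κ ≤ κ₁)
    (hL₁ : ∀ i, ∑ j, D i j * Real.exp (-((κ₀ - κ₁) * D i j)) ≤ L₁)
    (hL : ∀ i, ∑ j, Real.exp (-((κ₁ - κ) * D i j)) ≤ L) (hL0 : 0 ≤ L)
    (hb1 : κ₁ * ((aA + X₀ * aP) * (Nq / (mA - cA - X₀ * cP)) + 1) * L₁ < 1)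
    (hb2 : 2 * N / M * ((1 - κ₁ * ((aA + X₀ * aP) * (Nq / (mA - cA - X₀ * cP)) + 1) * L₁)⁻¹ * L)
        * (((aA + X₀ * aP) * (Nq / (mA - cA - X₀ * cP)) + 1) * L₁) < 1)
    {x : ℝ} (hx : 0 ≤ x) (hxX : x ≤ X₀) :
    IsUnit (sandwich (A + (x : ℂ) • P) q)
      ∧ WRS κ D (sandwich (A + (x : ℂ) • P) q)⁻¹
          ((aA + X₀ * aP) * (N * ((1 - κ₁ * ((aA + X₀ * aP) * (Nq / (mA - cA - X₀ * cP)) + 1) * L₁)⁻¹ * L)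
            * (1 - 2 * N / M * ((1 - κ₁ * ((aA + X₀ * aP) * (Nq / (mA - cA - X₀ * cP)) + 1) * L₁)⁻¹ * L)
              * (((aA + X₀ * aP) * (Nq / (mA - cA - X₀ * cP)) + 1) * L₁))⁻¹)) := by
  set Ax : Matrix X X ℂ := A + (x : ℂ) • P with hAx
  set m : ℝ := mA - cA - X₀ * cP with hmdef
  set a : ℝ := aA + X₀ * aP with hadef
  have ha : 0 < a := by rw [hadef]; nlinarith
  -- (1) the fine operator at x: Hermitian, Re-coercive, invertible, Re ≥ 0
  have hHx : Ax.IsHermitian := by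
    rw [hAx, Matrix.IsHermitian, Matrix.conjTranspose_add, Matrix.conjTranspose_smul, hHA.eq, hHP.eq,
      Complex.star_def, Complex.conj_ofReal]
  have hRex : ∀ g : X → ℂ, mA * nsq g ≤ (star g ⬝ᵥ (Ax *ᵥ g)).re := fun g =>
    reCoercive_add_of_re_nonneg hmA (fun g' => by
      rw [Matrix.smul_mulVec, dotProduct_smul, smul_eq_mul, Complex.re_ofReal_mul]
      exact mul_nonneg hx (hP g')) g
  have hUx : IsUnit Ax := isUnit_of_reCoercive hmA0 hRex
  have hpsdx : ∀ g : X → ℂ, 0 ≤ (star g ⬝ᵥ (Ax *ᵥ g)).re := fun g =>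
    le_trans (mul_nonneg hmA0.le (nsq_nonneg g)) (hRex g)
  -- (2) conjugated coercivity m of Ax along every block weight (budget: A costs c_A, xP costs x·c_P ≤ X·c_P)
  have hcx : ∀ y', ∀ z : X → ℂ, m * nsq z ≤ (conjForm Ax κ₀ (fun x' => D (blk x') y') z).re := by
    intro y' z
    have hPx : ∀ w : X → ℂ, (star w ⬝ᵥ ((((x : ℝ) : ℂ) • P) *ᵥ w)).re - X₀ * cP * nsq w
        ≤ (conjForm (((x : ℝ) : ℂ) • P) κ₀ (fun x' => D (blk x') y') w).re :=
      conjLower_mono (conjLower_real_smul (hPbud y') hx) (by nlinarith)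
    have hPnn : ∀ w : X → ℂ, 0 ≤ (star w ⬝ᵥ ((((x : ℝ) : ℂ) • P) *ᵥ w)).re := fun w => by
      rw [Matrix.smul_mulVec, dotProduct_smul, smul_eq_mul, Complex.re_ofReal_mul]
      exact mul_nonneg hx (hP w)
    have h := conjCoercive_add_of_re_nonneg hmA (hAbud y') hPnn hPx z
    rw [hmdef]
    exact h
  have hmpos : 0 < m := by rw [hmdef]; exact hm
  -- (3) decay and coercivity of the projection kernel S(x) = sandwich Ax q
  have hS : ∀ i j, ‖sandwich Ax q i j‖ ≤ Nq / m * Real.exp (-(κ₀ * D i j)) := by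
    intro i j
    have h := norm_sandwich_inv_le Ax blk D hw.zero q hq hNq hκ₀ hmpos hcx i j
    calc ‖sandwich Ax q i j‖ = ‖star (q i) ⬝ᵥ (Ax⁻¹ *ᵥ q j)‖ := rfl
      _ ≤ Nq * (Real.exp (-(κ₀ * D i j)) / m) := h
      _ = Nq / m * Real.exp (-(κ₀ * D i j)) := by ring
  have hθS : 0 ≤ Nq / m := div_nonneg hNq0 hmpos.le
  have henx : ∀ Bv : Y → ℂ, (star (superpose r Bv) ⬝ᵥ (Ax *ᵥ superpose r Bv)).re ≤ a * nsq Bv := by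
    intro Bv
    rw [hAx, Matrix.add_mulVec, dotProduct_add, Complex.add_re, Matrix.smul_mulVec, dotProduct_smul, smul_eq_mul,
      Complex.re_ofReal_mul, hadef]
    have h1 := henA Bv
    have h2 := henP Bv
    have h3 : 0 ≤ (star (superpose r Bv) ⬝ᵥ (P *ᵥ superpose r Bv)).re := hP _
    nlinarith [nsq_nonneg Bv]
  have hcoer : ∀ Bv : Y → ℂ, a⁻¹ * nsq Bv ≤ (star Bv ⬝ᵥ (sandwich Ax q *ᵥ Bv)).re :=
    sandwich_coercive_of_reconstruction Ax hHx hUx hpsdx q r hbi ha henx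
  -- (4) the walk inversion of the coercive decaying S(x)
  have hainv : 0 < a⁻¹ := inv_pos.2 ha
  have hb1' : κ₁ * ((a⁻¹)⁻¹ * (Nq / m) + 1) * L₁ < 1 := by rw [inv_inv]; exact hb1
  have hb2' : 2 * N / M * ((1 - κ₁ * ((a⁻¹)⁻¹ * (Nq / m) + 1) * L₁)⁻¹ * L)
      * (((a⁻¹)⁻¹ * (Nq / m) + 1) * L₁) < 1 := by
    rw [inv_inv]; exact hb2
  have hres := walkInversion_of_coercive hw hDs (sandwich Ax q) hainv hθS hcoer hS h E hsum hsupp habs hM hLip hN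
    hκκ₁ hL₁ hL hL0 hb1' hb2'
  rw [inv_inv] at hres
  exact hres

end

end Summit.QuantumFields.BalabanUV.Beta.UnitLatticeProjectionWalk
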